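import Summits.QuantumAdvantage.QuantumAdvantage.Theorems.BlindDialA

/-!
# BlindDial part B (§3–§4: blind fields, the involution `win_flip`, the finite core and reachability) — Theorems twin
(tree landing, census lane decomp-qadv) of NODE «BlindDial» (decomp-qadv-lens-2, gen 20)

Verbatim content of §3–§4 (up to `AA_le`) of the lens node file
`run/shared/lean/pub/decomp-qadv/decomp-qadv-lens-2/g20/BlindDial.lean` (sha256 b5816ebc…, 919 l; farm rc 0 · 0 err · 0 warn ·
0 sorry; axioms std) under the `Theorems.BlindDial` namespace (the node elaborates under `Theses.BlindDial`); every declaration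
documented; linear import chain `ResponseDialJ → BlindDialA → BlindDialB → BlindDialC`.
Supports stmt-QuantumAdvantage-27656 (`Theses.SparsityDial.DenseGenericLoss3` = D, DRAFT route-QuantumAdvantage-SparsityDial).
Main results here: `Blind` (the structured class), `win_flip` (the pair move `τ_e` flips the win bit on `Δ_e = 1`),
`QQ_le` (`#Q ≤ 2·#losers`), `core` (`decide`, 2¹¹ × 16 cases), `reach` / `AA_le` (`#A ≤ 16·#Q`).
-/


set_option linter.dupNamespace false
noncomputable section
open scoped Classical

namespace Summit.QuantumAdvantage.QuantumAdvantage.Theorems.BlindDial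
open Finset
open Literature.Computability.QuantumComplexity Literature.Computability.QuantumComplexity.RingHLF
open Literature.Computability.MetaComplexity Literature.Computability.MetaComplexity.Smolensky
open Summit.QuantumAdvantage.AdviceFreeQNC0
open Summit.QuantumAdvantage.QuantumAdvantage.Theorems.AnchorDial (outB dev cN fz fz_apply orbL orbL_cons orbL_nil
  oddZeros_orbL zpar_orbL orbL_apply_of_far cN_orbL orbL_invol card_filter_orbL sh sgN cN_succ win_iff gCond_iff_cN
  flip2 zpar_flip2 loss_shape_mono)
open Summit.QuantumAdvantage.QuantumAdvantage.Theorems.HolonomyDial (gCond tPoly tPoly_apply xorP xorP_apply_bool indP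
  indP_apply mono_singleton_apply)
open Summit.QuantumAdvantage.QuantumAdvantage.Theorems.StabilizerDial (apIdx apStrat bitP bitP_apStrat pad rel_pad_iff
  StabFew)
open Summit.QuantumAdvantage.QuantumAdvantage.Theorems.SparsityDial (real_loss_of_frac)
open Summit.QuantumAdvantage.QuantumAdvantage.Theorems.ResponseDial (loddG wStrat wStrat_agree wStrat_mem paleyW
  WindowCounterLoss3 PaleyCounterLoss3 windowCounterLoss3_of_dense wStrat_in_dense_class tog0 oddZeros_tog0
  fibre_le_pow mem_dev_apStrat mcStrat MultiCounterLoss3 mcStrat_eq_wStrat)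
open Summit.QuantumAdvantage.QuantumAdvantage.Theses.SparsityDial (DenseGenericLoss3)

variable {N : ℕ}

/-! ## §3 BLIND fields -/

/-- the bit of cell `j` (junk `false` off the cycle). -/
def bit (x : Fin N → Bool) (j : ℕ) : Bool := if h : j < N then x ⟨j, h⟩ else false

/-- BlindDialB helper `bit_eq` (decomp-qadv g20 land package; see the module docstring). -/
theorem bit_eq (x : Fin N → Bool) {j : ℕ} (h : j < N) : bit x j = x ⟨j, h⟩ := by unfold bit; rw [dif_pos h]

/-- the POINTER part of position `k`'s deviation: the watched cell `x_e` at the reader `k₀`, `x_{e+2}` at `k₀ + 2`,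
nothing elsewhere. -/
def ptr (N k : ℕ) (x : Fin N → Bool) : Bool :=
  if k = kW N then bit x (eW N) else if k = kW N + 2 then bit x (eW N + 2) else false

/-- BlindDialB helper `ptr_of_ne` (decomp-qadv g20 land package; see the module docstring). -/
theorem ptr_of_ne {k : ℕ} (h0 : k ≠ kW N) (h2 : k ≠ kW N + 2) (y : Fin N → Bool) : ptr N k y = false := by
  unfold ptr; rw [if_neg h0, if_neg h2]

/-- BlindDialB helper `ptr_K0` (decomp-qadv g20 land package; see the module docstring). -/
theorem ptr_K0 (y : Fin N → Bool) : ptr N (kW N) y = bit y (eW N) := by unfold ptr; rw [if_pos rfl]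

/-- BlindDialB helper `ptr_K2` (decomp-qadv g20 land package; see the module docstring). -/
theorem ptr_K2 (y : Fin N → Bool) : ptr N (kW N + 2) y = bit y (eW N + 2) := by
  unfold ptr; rw [if_neg (by omega), if_pos rfl]

/-- **BLIND FIELD** (the structured side; no degree, sparsity, window or equivariance hypothesis).  Position `k`
deviates from the canonical guess at `x` iff `B_k(x) ⊕ ptr_k(x)`, where EVERY `B_k` is blind to the ten moved cells:
the pointer readers `k₀, k₀ + 2` watch the pair `{e, e+2}` and nothing else about the field's deviations sees that
pair or the eight rotation cells. -/
def Blind (P : Fin N → CubeFn (ZMod 3) N) : Prop :=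
  ∃ B : Fin N → (Fin N → Bool) → Bool,
    (∀ k : Fin N, ∀ y y' : Fin N → Bool, (∀ j : Fin N, ¬ Moved N j.val → y j = y' j) → B k y = B k y') ∧
    ∀ k : Fin N, ∀ y : Fin N → Bool, k ∈ dev P y ↔ xor (B k y) (ptr N k.val y) = true

/-! ## §4 The engine (scale `N ≥ 64`) -/


/-- the parity cell `e + 1` between the watched pair (pinned to `0`). -/
def E1 (hN : 64 ≤ N) : Fin N := ⟨eW N + 1, by unfold eW; omega⟩

/-- the pointer readers `k₀`, `k₀ + 2` and the cell `k₀ + 1` between them (pinned to `1`). -/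
def K0 (hN : 64 ≤ N) : Fin N := ⟨kW N, by unfold kW; omega⟩

/-- BlindDialB helper `K1` (decomp-qadv g20 land package; see the module docstring). -/
def K1 (hN : 64 ≤ N) : Fin N := ⟨kW N + 1, by unfold kW; omega⟩

/-- BlindDialB helper `K2` (decomp-qadv g20 land package; see the module docstring). -/
def K2 (hN : 64 ≤ N) : Fin N := ⟨kW N + 2, by unfold kW; omega⟩

/-- **the move** `τ_e`: flip the watched pair. -/
def tau (x : Fin N → Bool) : Fin N → Bool := pmv true (eW N) x

/-- the kernel bit `g_k(x) = [c_k(x) ≢ 2]`. -/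
def gb (x : Fin N → Bool) (k : ℕ) : Bool := decide (cN x k % 3 ≠ 2)

/-- the kernel bit of position `k` after a sign shift `sgN (zpar x k)` (what `τ_e` does to position `e + 1`). -/
def gs (x : Fin N → Bool) (k : ℕ) : Bool := decide ((cN x k + sgN (zpar x k)) % 3 ≠ 2)

/-- **the invariant `Δ_e(x)`**: the parity change of the good-deviation count under `τ_e` (inputs with `x_{e+1} = 0`):
the two pointer readers always toggle their deviation and contribute their kernel bits; position `e + 1` keeps its
deviation bit `d` and contributes `d ∧ [its kernel bit moves]`; nothing else moves. -/
def delta (hN : 64 ≤ N) (P : Fin N → CubeFn (ZMod 3) N) (x : Fin N → Bool) : Bool :=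
  xor (xor (gb x (kW N)) (gb x (kW N + 2))) (decide (E1 hN ∈ dev P x) && xor (gb x (eW N + 1)) (gs x (eW N + 1)))

/-- BlindDialB helper `tau_odd` (decomp-qadv g20 land package; see the module docstring). -/
theorem tau_odd (hN : 64 ≤ N) (x : Fin N → Bool) : OddZeros (tau x) ↔ OddZeros x :=
  oddZeros_pmv true (by unfold eW; omega) x

/-- BlindDialB helper `tau_E1` (decomp-qadv g20 land package; see the module docstring). -/
theorem tau_E1 (hN : 64 ≤ N) (x : Fin N → Bool) : tau x (E1 hN) = x (E1 hN) :=
  pmv_apply_of_ne true x (show eW N + 1 ≠ eW N by omega) (show eW N + 1 ≠ eW N + 2 by omega)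

/-- BlindDialB helper `cN_tau_of_ne` (decomp-qadv g20 land package; see the module docstring). -/
theorem cN_tau_of_ne (hN : 64 ≤ N) (x : Fin N → Bool) (he1 : x (E1 hN) = false) (k : ℕ) (hk : k ≤ N)
    (hne : k ≠ eW N + 1) : cN (tau x) k % 3 = cN x k % 3 := by
  unfold tau; rw [cN_pmv_mid_false (by unfold eW; omega) x he1 k hk, if_neg hne, add_zero]

/-- BlindDialB helper `cN_tau_E1` (decomp-qadv g20 land package; see the module docstring). -/
theorem cN_tau_E1 (hN : 64 ≤ N) (x : Fin N → Bool) (he1 : x (E1 hN) = false) :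
    cN (tau x) (eW N + 1) % 3 = (cN x (eW N + 1) + sgN (zpar x (eW N + 1))) % 3 := by
  unfold tau; rw [cN_pmv_mid_false (by unfold eW; omega) x he1 _ (by unfold eW; omega), if_pos rfl]

/-- BlindDialB helper `zpar_tau_E1` (decomp-qadv g20 land package; see the module docstring). -/
theorem zpar_tau_E1 (hN : 64 ≤ N) (x : Fin N → Bool) : zpar (tau x) (eW N + 1) = !zpar x (eW N + 1) :=
  zpar_pmv_succ (by unfold eW; omega) x

/-- BlindDialB helper `tau_agree` (decomp-qadv g20 land package; see the module docstring). -/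
theorem tau_agree (x : Fin N → Bool) (j : Fin N) (hj : ¬ Moved N j.val) : tau x j = x j :=
  pmv_apply_of_ne true x (by unfold Moved at hj; omega) (by unfold Moved at hj; omega)

/-- deviations under `τ_e`: unchanged off the two pointer readers … -/
theorem dev_tau_same (_hN : 64 ≤ N) {P : Fin N → CubeFn (ZMod 3) N} (hB : Blind P) (x : Fin N → Bool) (k : Fin N)
    (h0 : k.val ≠ kW N) (h2 : k.val ≠ kW N + 2) : k ∈ dev P (tau x) ↔ k ∈ dev P x := by
  obtain ⟨B, hBl, hdv⟩ := hB
  rw [hdv, hdv, hBl k (tau x) x (fun j hj => tau_agree x j hj), ptr_of_ne h0 h2, ptr_of_ne h0 h2]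

/-- … and TOGGLED at the two pointer readers. -/
theorem dev_tau_flip (hN : 64 ≤ N) {P : Fin N → CubeFn (ZMod 3) N} (hB : Blind P) (x : Fin N → Bool) (k : Fin N)
    (h : k.val = kW N ∨ k.val = kW N + 2) : k ∈ dev P (tau x) ↔ k ∉ dev P x := by
  obtain ⟨B, hBl, hdv⟩ := hB
  have hxor : ∀ a c : Bool, (xor a (!c) = true ↔ ¬ xor a c = true) := by decide
  have heN : eW N + 2 < N := by unfold eW; omega
  rw [hdv, hdv, hBl k (tau x) x (fun j hj => tau_agree x j hj)]
  rcases h with h | h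
  · rw [h, ptr_K0, ptr_K0, bit_eq _ (show eW N < N by omega), bit_eq _ (show eW N < N by omega)]
    unfold tau; rw [pmv_apply, if_pos ⟨rfl, Or.inl rfl⟩]; exact hxor _ _
  · rw [h, ptr_K2, ptr_K2, bit_eq _ heN, bit_eq _ heN]
    unfold tau; rw [pmv_apply, if_pos ⟨rfl, Or.inr rfl⟩]; exact hxor _ _

/-- deviations under a rotation: unchanged everywhere. -/
theorem dev_rot (hN : 64 ≤ N) {P : Fin N → CubeFn (ZMod 3) N} (hB : Blind P) (ε : B4) (y : Fin N → Bool)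
    (k : Fin N) : k ∈ dev P (rot ε y) ↔ k ∈ dev P y := by
  obtain ⟨B, hBl, hdv⟩ := hB
  have heN : eW N + 2 < N := by unfold eW; omega
  have hp : ptr N k.val (rot ε y) = ptr N k.val y := by
    unfold ptr
    rw [bit_eq _ (show eW N < N by omega), bit_eq _ (show eW N < N by omega), bit_eq _ heN, bit_eq _ heN,
      rot_apply_of_ne ε y _ (show NotRot (eW N) by unfold NotRot eW; omega),
      rot_apply_of_ne ε y _ (show NotRot (eW N + 2) by unfold NotRot eW; omega)]
  rw [hdv, hdv, hBl k (rot ε y) y (fun j hj => rot_apply_of_not_moved ε y j hj), hp]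

/-- `Δ_e` is `τ_e`-invariant. -/
theorem delta_tau (hN : 64 ≤ N) {P : Fin N → CubeFn (ZMod 3) N} (hB : Blind P) (x : Fin N → Bool)
    (he1 : x (E1 hN) = false) : delta hN P (tau x) = delta hN P x := by
  have hk := kW_bound N
  have hT4 := cN_tau_E1 hN x he1
  have g0 : gb (tau x) (kW N) = gb x (kW N) := by
    unfold gb; rw [cN_tau_of_ne hN x he1 _ (by omega) (by unfold eW; omega)]
  have g2 : gb (tau x) (kW N + 2) = gb x (kW N + 2) := by
    unfold gb; rw [cN_tau_of_ne hN x he1 _ (by omega) (by unfold eW; omega)]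
  have g1 : gb (tau x) (eW N + 1) = gs x (eW N + 1) := by unfold gb gs; rw [hT4]
  have g1' : gs (tau x) (eW N + 1) = gb x (eW N + 1) := by
    unfold gb gs; rw [zpar_tau_E1 hN x]
    have h3 : ∀ z : Bool, sgN z + sgN (!z) = 3 := by decide
    have := h3 (zpar x (eW N + 1))
    rw [show (cN (tau x) (eW N + 1) + sgN (!zpar x (eW N + 1))) % 3 = cN x (eW N + 1) % 3 by omega]
  have d1 : decide (E1 hN ∈ dev P (tau x)) = decide (E1 hN ∈ dev P x) := by
    rw [decide_eq_decide]
    exact dev_tau_same hN hB x (E1 hN) (show eW N + 1 ≠ kW N by unfold eW; omega)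
      (show eW N + 1 ≠ kW N + 2 by unfold eW; omega)
  unfold delta; rw [g0, g2, g1, g1', d1, Bool.xor_comm (gs x (eW N + 1)) (gb x (eW N + 1))]

/-- the good-deviation set `F(y) = {k ∈ dev(y) : g_k(y)}`; its parity is the win bit (`win_iff`). -/
def Fset (P : Fin N → CubeFn (ZMod 3) N) (y : Fin N → Bool) : Finset (Fin N) :=
  (dev P y).filter fun k : Fin N => gCond y k.val

/-- the three positions that move under `τ_e`. -/
def S3 (hN : 64 ≤ N) : Finset (Fin N) := {K0 hN, K2 hN, E1 hN}

/-- BlindDialB helper `parity_core` (decomp-qadv g20 land package; see the module docstring). -/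
theorem parity_core : ∀ (d0 g0 d2 g2 d1 g1 g1' : Bool), xor (xor g0 g2) (d1 && xor g1 g1') = true →
    (((!d0 && g0).toNat + ((!d2 && g2).toNat + (d1 && g1').toNat)) +
      ((d0 && g0).toNat + ((d2 && g2).toNat + (d1 && g1).toNat))) % 2 = 1 := by decide

/-- BlindDialB helper `ite_toNat` (decomp-qadv g20 land package; see the module docstring). -/
theorem ite_toNat (p : Prop) [Decidable p] (b : Bool) (h : p ↔ b = true) : (if p then 1 else 0 : ℕ) = b.toNat := by
  cases b
  · rw [if_neg (fun hp => Bool.false_ne_true (h.1 hp))]; rfl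
  · rw [if_pos (h.2 rfl)]; rfl

/-- **THE INVOLUTION**: on inputs with `x_{e+1} = 0` and `Δ_e(x) = 1`, the pair move `τ_e` FLIPS the win bit. -/
theorem win_flip (hN : 64 ≤ N) {P : Fin N → CubeFn (ZMod 3) N} (hB : Blind P) (x : Fin N → Bool) (hx : OddZeros x)
    (he1 : x (E1 hN) = false) (hΔ : delta hN P x = true) : (Rel (tau x) (outB P (tau x)) ↔ ¬ Rel x (outB P x)) := by
  have hN3 : 3 ≤ N := by omega
  have hk := kW_bound N
  have hxt : OddZeros (tau x) := (tau_odd hN x).2 hx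
  rw [win_iff hN3 P _ hxt, win_iff hN3 P x hx]
  show (Fset P (tau x)).card % 2 = 1 ↔ ¬ ((Fset P x).card % 2 = 1)
  have hsplit : ∀ y : Fin N → Bool, (Fset P y).card =
      ((S3 hN).filter fun k => k ∈ Fset P y).card + (Fset P y \ S3 hN).card := by
    intro y; rw [filter_mem_eq_inter, inter_comm, ← card_sdiff_add_card_inter (Fset P y) (S3 hN), add_comm]
  have hoff : Fset P (tau x) \ S3 hN = Fset P x \ S3 hN := by
    ext k
    rw [mem_sdiff, mem_sdiff]
    by_cases hk3 : k ∈ S3 hN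
    · simp [hk3]
    · have hk' := hk3
      simp only [S3, mem_insert, mem_singleton, not_or] at hk'
      have h0 : k.val ≠ kW N := fun h => hk'.1 (Fin.ext h)
      have h2 : k.val ≠ kW N + 2 := fun h => hk'.2.1 (Fin.ext h)
      have h1 : k.val ≠ eW N + 1 := fun h => hk'.2.2 (Fin.ext h)
      rw [Fset, Fset, mem_filter, mem_filter, dev_tau_same hN hB x k h0 h2, gCond_iff_cN, gCond_iff_cN,
        cN_tau_of_ne hN x he1 k.val (by omega) h1]
  have h3sum : ∀ y : Fin N → Bool, ((S3 hN).filter fun k => k ∈ Fset P y).card =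
      (if K0 hN ∈ Fset P y then 1 else 0) + ((if K2 hN ∈ Fset P y then 1 else 0) +
        (if E1 hN ∈ Fset P y then 1 else 0)) := by
    intro y
    rw [card_filter, S3, sum_insert, sum_insert, sum_singleton]
    · simp only [mem_singleton, K2, E1, Fin.mk.injEq]; unfold eW; omega
    · simp only [mem_insert, mem_singleton, K0, K2, E1, Fin.mk.injEq]; unfold eW; omega
  have t1 : (if K0 hN ∈ Fset P (tau x) then 1 else 0 : ℕ) = (!decide (K0 hN ∈ dev P x) && gb x (kW N)).toNat := by
    apply ite_toNat
    rw [Fset, mem_filter, dev_tau_flip hN hB x (K0 hN) (Or.inl rfl), gCond_iff_cN, show (K0 hN).val = kW N from rfl,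
      cN_tau_of_ne hN x he1 _ (show kW N ≤ N by omega) (show kW N ≠ eW N + 1 by unfold eW; omega)]
    unfold gb; simp [K0]
  have t2 : (if K2 hN ∈ Fset P (tau x) then 1 else 0 : ℕ) =
      (!decide (K2 hN ∈ dev P x) && gb x (kW N + 2)).toNat := by
    apply ite_toNat
    rw [Fset, mem_filter, dev_tau_flip hN hB x (K2 hN) (Or.inr rfl), gCond_iff_cN,
      show (K2 hN).val = kW N + 2 from rfl,
      cN_tau_of_ne hN x he1 _ (show kW N + 2 ≤ N by omega) (show kW N + 2 ≠ eW N + 1 by unfold eW; omega)]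
    unfold gb; simp [K2]
  have t3 : (if E1 hN ∈ Fset P (tau x) then 1 else 0 : ℕ) =
      (decide (E1 hN ∈ dev P x) && gs x (eW N + 1)).toNat := by
    apply ite_toNat
    rw [Fset, mem_filter, dev_tau_same hN hB x (E1 hN) (show eW N + 1 ≠ kW N by unfold eW; omega)
      (show eW N + 1 ≠ kW N + 2 by unfold eW; omega), gCond_iff_cN, show (E1 hN).val = eW N + 1 from rfl,
      cN_tau_E1 hN x he1]
    unfold gs; simp
  have t4 : (if K0 hN ∈ Fset P x then 1 else 0 : ℕ) = (decide (K0 hN ∈ dev P x) && gb x (kW N)).toNat := by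
    apply ite_toNat; rw [Fset, mem_filter, gCond_iff_cN]; unfold gb; simp [K0]
  have t5 : (if K2 hN ∈ Fset P x then 1 else 0 : ℕ) = (decide (K2 hN ∈ dev P x) && gb x (kW N + 2)).toNat := by
    apply ite_toNat; rw [Fset, mem_filter, gCond_iff_cN]; unfold gb; simp [K2]
  have t6 : (if E1 hN ∈ Fset P x then 1 else 0 : ℕ) = (decide (E1 hN ∈ dev P x) && gb x (eW N + 1)).toNat := by
    apply ite_toNat; rw [Fset, mem_filter, gCond_iff_cN]; unfold gb; simp [E1]
  have hpar := parity_core (decide (K0 hN ∈ dev P x)) (gb x (kW N)) (decide (K2 hN ∈ dev P x)) (gb x (kW N + 2))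
    (decide (E1 hN ∈ dev P x)) (gb x (eW N + 1)) (gs x (eW N + 1)) (by unfold delta at hΔ; exact hΔ)
  rw [hsplit (tau x), hsplit x, hoff, h3sum (tau x), h3sum x, t1, t2, t3, t4, t5, t6]
  constructor <;> intro h <;> omega

/-- the involution domain `Q_e`: odd inputs with `x_{e+1} = 0` and `Δ_e(x) = 1`. -/
def QQ (hN : 64 ≤ N) (P : Fin N → CubeFn (ZMod 3) N) (x : Fin N → Bool) : Prop :=
  OddZeros x ∧ x (E1 hN) = false ∧ delta hN P x = true

/-- BlindDialB helper `QQ_tau` (decomp-qadv g20 land package; see the module docstring). -/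
theorem QQ_tau (hN : 64 ≤ N) {P : Fin N → CubeFn (ZMod 3) N} (hB : Blind P) (x : Fin N → Bool) (h : QQ hN P x) :
    QQ hN P (tau x) :=
  ⟨(tau_odd hN x).2 h.1, by rw [tau_E1 hN x]; exact h.2.1, by rw [delta_tau hN hB x h.2.1]; exact h.2.2⟩

/-- **involution count**: `#Q_e ≤ 2 · #{odd losers}`. -/
theorem QQ_le (hN : 64 ≤ N) {P : Fin N → CubeFn (ZMod 3) N} (hB : Blind P) :
    (univ.filter fun x : Fin N → Bool => QQ hN P x).card ≤
      2 * (univ.filter fun x : Fin N → Bool => OddZeros x ∧ ¬ Rel x (outB P x)).card := by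
  have hsplit := Finset.card_filter_add_card_filter_not (s := univ.filter fun x : Fin N → Bool => QQ hN P x)
    (p := fun x : Fin N → Bool => Rel x (outB P x))
  have hW : ((univ.filter fun x : Fin N → Bool => QQ hN P x).filter fun x => Rel x (outB P x)).card ≤
      ((univ.filter fun x : Fin N → Bool => QQ hN P x).filter fun x => ¬ Rel x (outB P x)).card := by
    have hτ := card_filter_orbL (fun x : Fin N → Bool => QQ hN P x ∧ ¬ Rel x (outB P x))
      [(true, eW N), (true, eW N + 1)]
    rw [filter_filter, filter_filter, ← hτ]
    apply card_le_card
    intro x hx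
    rw [mem_filter] at hx ⊢
    refine ⟨mem_univ _, QQ_tau hN hB x hx.2.1, fun hw => ?_⟩
    exact (win_flip hN hB x hx.2.1.1 hx.2.1.2.1 hx.2.1.2.2).1 hw hx.2.2
  have hL : ((univ.filter fun x : Fin N → Bool => QQ hN P x).filter fun x => ¬ Rel x (outB P x)).card ≤
      (univ.filter fun x : Fin N → Bool => OddZeros x ∧ ¬ Rel x (outB P x)).card := by
    rw [filter_filter]; apply card_le_card; intro x hx; rw [mem_filter] at hx ⊢; exact ⟨hx.1, hx.2.1.1, hx.2.2⟩
  omega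

/-- the PINNED inputs `A`: odd, `x_{e+1} = 0`, `x_{k₀+1} = 1`, sign cells `1`. -/
def AA (hN : 64 ≤ N) (x : Fin N → Bool) : Prop := OddZeros x ∧ x (E1 hN) = false ∧ x (K1 hN) = true ∧ SignFix x

/-- the finite core of the reachability step: the profile of `Δ_e` along the 16 rotations, as a function of the
residues `c_{k₀}, c_{e+1} (mod 3)`, the parities `u = zpar (k₀+1)`, `z = zpar (e+1)`, the deviation bit `d` of
position `e+1`, and the four sign parities. -/
def coreD (c₁ c₂ : ℕ) (u z d : Bool) (T M : ℕ) : Bool :=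
  xor (xor (decide ((c₁ + T + 2 * M) % 3 ≠ 2))
        (decide ((c₁ + 2 + (if u = true then 1 else 0) + (if u = true then 1 else 0) + T + 2 * M) % 3 ≠ 2)))
    (d && xor (decide ((c₂ + T + M) % 3 ≠ 2)) (decide ((c₂ + T + M + sgN z) % 3 ≠ 2)))

/-- **finite core** (`decide`, 1152 × 16 cases): some rotation makes `Δ_e = 1`. -/
theorem core : ∀ (c₁ c₂ : Fin 3) (u z d z₁ z₅ z₁₁ z₁₅ : Bool), ∃ ε : B4,
    coreD c₁.val c₂.val u z d (Tof ε.1 ε.2.1 z₁ z₅) (Tof ε.2.2.1 ε.2.2.2 z₁₁ z₁₅) = true := by decide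

/-- **REACHABILITY**: every pinned input has a rotation inside the involution domain. -/
theorem reach (hN : 64 ≤ N) {P : Fin N → CubeFn (ZMod 3) N} (hB : Blind P) (x : Fin N → Bool) (hA : AA hN x) :
    ∃ ε : B4, QQ hN P (rot ε x) := by
  obtain ⟨hodd, he1, hk1, hsf⟩ := hA
  have hk := kW_bound N
  have h18 : 18 ≤ N := by omega
  obtain ⟨ε, hε⟩ := core ⟨cN x (kW N) % 3, Nat.mod_lt _ (by norm_num)⟩
    ⟨cN x (eW N + 1) % 3, Nat.mod_lt _ (by norm_num)⟩ (zpar x (kW N + 1)) (zpar x (eW N + 1))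
    (decide (E1 hN ∈ dev P x)) (zpar x 1) (zpar x 5) (zpar x 11) (zpar x 15)
  refine ⟨ε, (oddZeros_rot h18 ε x).2 hodd, ?_, ?_⟩
  · rw [rot_apply_of_not_moved ε x (E1 hN) (not_moved_of_odd (show (eW N + 1) % 2 = 1 by unfold eW; omega))]
    exact he1
  · have hu : zpar x (kW N + 2) = zpar x (kW N + 1) := by
      rw [show kW N + 2 = (kW N + 1) + 1 by omega, zpar_succ x (show kW N + 1 < N by omega)]
      have hk1' : x ⟨kW N + 1, by omega⟩ = true := hk1
      rw [hk1']; simp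
    have c2 : cN x (kW N + 2) = cN x (kW N) + 2 + (if zpar x (kW N + 1) = true then 1 else 0) +
        (if zpar x (kW N + 1) = true then 1 else 0) := by
      have a := cN_succ x (kW N) (by omega)
      have b := cN_succ x (kW N + 1) (by omega)
      rw [show kW N + 1 + 1 = kW N + 2 by omega, hu] at b
      omega
    have g0 : cN (rot ε x) (kW N) % 3 = (cN x (kW N) % 3 + TT ε x + 2 * MM ε x) % 3 := by
      rw [cN_rot_low h18 ε x hsf (kW N) (by omega)]; omega
    have g2 : cN (rot ε x) (kW N + 2) % 3 = (cN x (kW N) % 3 + 2 + (if zpar x (kW N + 1) = true then 1 else 0) +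
        (if zpar x (kW N + 1) = true then 1 else 0) + TT ε x + 2 * MM ε x) % 3 := by
      rw [cN_rot_low h18 ε x hsf (kW N + 2) (by omega), c2]; omega
    have g1 : cN (rot ε x) (eW N + 1) % 3 = (cN x (eW N + 1) % 3 + TT ε x + MM ε x) % 3 := by
      rw [cN_rot_high h18 ε x hsf (eW N + 1) (by unfold eW; omega)]; omega
    have g1' : (cN (rot ε x) (eW N + 1) + sgN (zpar (rot ε x) (eW N + 1))) % 3 =
        (cN x (eW N + 1) % 3 + TT ε x + MM ε x + sgN (zpar x (eW N + 1))) % 3 := by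
      rw [zpar_rot h18 ε x (eW N + 1) (by unfold eW; omega) (by unfold eW; omega)]
      have := cN_rot_high h18 ε x hsf (eW N + 1) (by unfold eW; omega)
      omega
    have d1 : decide (E1 hN ∈ dev P (rot ε x)) = decide (E1 hN ∈ dev P x) := by
      rw [decide_eq_decide]; exact dev_rot hN hB ε x (E1 hN)
    have key : delta hN P (rot ε x) = coreD (cN x (kW N) % 3) (cN x (eW N + 1) % 3) (zpar x (kW N + 1))
        (zpar x (eW N + 1)) (decide (E1 hN ∈ dev P x)) (TT ε x) (MM ε x) := by
      unfold delta gb gs coreD; rw [g0, g2, g1, g1', d1]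
    rw [key]; exact hε

/-- **rotation count**: `#A ≤ 16 · #Q_e`. -/
theorem AA_le (hN : 64 ≤ N) {P : Fin N → CubeFn (ZMod 3) N} (hB : Blind P) :
    (univ.filter fun x : Fin N → Bool => AA hN x).card ≤ 16 * (univ.filter fun x : Fin N → Bool => QQ hN P x).card := by
  have h16 : Fintype.card B4 = 16 := by simp [B4, Fintype.card_prod, Fintype.card_bool]
  calc (univ.filter fun x : Fin N → Bool => AA hN x).card
      ≤ ((univ : Finset B4).biUnion fun ε => univ.filter fun x : Fin N → Bool => QQ hN P (rot ε x)).card := by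
        apply card_le_card
        intro x hx
        rw [mem_filter] at hx
        rw [mem_biUnion]
        obtain ⟨ε, hε⟩ := reach hN hB x hx.2
        exact ⟨ε, mem_univ _, mem_filter.2 ⟨mem_univ _, hε⟩⟩
    _ ≤ ∑ ε : B4, (univ.filter fun x : Fin N → Bool => QQ hN P (rot ε x)).card := card_biUnion_le
    _ = ∑ ε : B4, (univ.filter fun x : Fin N → Bool => QQ hN P x).card := by
        refine sum_congr rfl fun ε _ => ?_
        simp only [rot_eq_orbL]
        exact card_filter_orbL (fun x : Fin N → Bool => QQ hN P x) (rotL ε)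
    _ = 16 * (univ.filter fun x : Fin N → Bool => QQ hN P x).card := by
        rw [sum_const, card_univ, h16, smul_eq_mul]


end Summit.QuantumAdvantage.QuantumAdvantage.Theorems.BlindDial
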